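import Summits.CriticalPhenomena.PercolationContinuityZ3.Theorems.FK.SusceptibilitySumRule
import Literature.Probability.LatticeModels.MeanFieldLowerBound
import Mathlib.MeasureTheory.Integral.IntegralEqImproper
import HarnessLib

/-!
# THE IMPROPER SUSCEPTIBILITY SUM RULE `m(β,h) − m*(β) = β ∫_{(0,h]} σ²(β,t) dt`: `σ²(β,·)` IS INTEGRABLE AT `0⁺` EVEN
# WHERE IT DIVERGES (Ellis 2006, Lemma V.7.4 / (5.28) integrated down to `h = 0`; Friedli–Velenik 2017, Lemma 3.31, §3.7.4)

Claimed R42 (8)(c) in the cell INBOX at 2026-08-29T01:14:38Z by fkp-10a gen 357 (NEW CLAIM #2 of the gen), addressed to coordinator fk-4 gen 288 (seated 01:00Z 2026-08-29 by l.8634; R160 = row FO-10a-g357); lineage row FO-10a-g357f (self-suggested), package g357-field, label HF-A.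
Helper file of the `fk-continuity` build cell (bschramm lane; `--supports stmt-CriticalPhenomena-4575`); builds on
p205010 (kernel theorem, internal audit signed; external expert review pending). No definitions, no named facts, no
sorries; standard axioms. UNCONDITIONAL (nearest-neighbour Ising model on `ℤ^d`, every `d`).

Notation (written out, no definitions): `m(h) = magnetizationInField d β h = ⟨σ_0⟩⁺_{β,h}`, `m*(β) = m(β,0)`,
`σ²(β,t) = Σ'_z (⟨σ_{{0}∆{z}}⟩⁺_{β,t} − ⟨σ_0⟩⁺_{β,t}⟨σ_z⟩⁺_{β,t})`. The tree's sum rule `∫_a^b β σ²(β,t) dt = m(β,b) − m(β,a)`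
(`integral_mul_tsum_plusTruncated_eq`, `SusceptibilitySumRule`) holds for `0 < a ≤ b`; at `a = 0` the integrand may blow
up (`σ²(β_c, t) → ∞` as `t ↓ 0`: `tendsto_tsum_plusTruncated_atTop_of_not_summable` with `χ(β_c) = ∞`). Since `σ² ≥ 0`
and `∫_a^h β σ² = m(h) − m(a) ≤ m(h) − m*(β) ≤ 1` uniformly in `a > 0`, and `m(β,·)` is RIGHT-CONTINUOUS AT `0` with
`m(β,0⁺) = m*(β)` (Friedli–Velenik Lemma 3.31 (1), tree theorem `plusCorr_continuousWithinAt_Ici_field`):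

* `continuousWithinAt_magnetizationInField_Ici_zero`, `tendsto_magnetizationInField_nhdsGT_zero` — `m(β,h) → m*(β)` as
  `h ↓ 0` (`β ≥ 0`);
* `setIntegral_tsum_plusTruncated_Ioc_eq` — `∫_{(a,h]} σ²(β,t) dt = (m(β,h) − m(β,a))/β` for `0 < a ≤ h`, hence
  `≤ (m(β,h) − m*(β))/β` (`setIntegral_tsum_plusTruncated_Ioc_le`);
* **`integrableOn_tsum_plusTruncated_Ioc`** — **`σ²(β,·) ∈ L¹((0,h])`** for every `β > 0`, `h > 0` (improper
  integrability at `0⁺`, Mathlib `integrableOn_Ioc_of_intervalIntegral_norm_bounded_left`), `intervalIntegrable_tsum_plusTruncated_zero`;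
* **`integral_mul_tsum_plusTruncated_Ioc_zero_eq`** — **THE IMPROPER SUM RULE `∫_{(0,h]} β σ²(β,t) dt = m(β,h) − m*(β)`**
  (`β > 0`, `h > 0`; monotone exhaustion `(h/(n+2), h] ↑ (0,h]` and `m(β, h/(n+2)) → m*(β)`); interval form
  `integral_mul_tsum_plusTruncated_eq_zero` (`∫_0^h β σ² = m(h) − m*`) and `magnetizationInField_eq_add_integral`
  (`m(β,h) = m*(β) + ∫_0^h β σ²(β,t) dt`);
* `integral_tsum_plusTruncated_Ioc_le` — `∫_{(0,h]} σ²(β,t) dt ≤ (1 − m*(β))/β`: the total susceptibility mass near `h = 0`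
  is bounded even at and above `β_c`, where `σ²(β,0⁺)` may be infinite;
* AT `β_c` (`d ≥ 2`): `not_summable_plusTruncated_zero_field_criticalBeta` (`σ²(β_c,0) = χ(β_c) = ∞`, Aizenman–Barsky–
  Fernández, tree theorem `susceptibility_eq_top_of_criticalBeta_le`), **`tendsto_tsum_plusTruncated_atTop_criticalBeta`**
  (`σ²(β_c,t) → ∞` as `t ↓ 0`) and **`integral_mul_tsum_plusTruncated_Ioc_zero_criticalBeta`** — THE CRITICAL ISOTHERM IS
  THE INTEGRATED DIVERGENT SUSCEPTIBILITY, `∫_{(0,h]} β_c σ²(β_c,t) dt = m(β_c,h)` (`m*(β_c) = 0`, tree theorem).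

## References

* R. S. Ellis, *Entropy, Large Deviations, and Statistical Mechanics*, Springer (1985/2006), Lemma V.7.4, eq. (5.28),
  Thm. V.7.2 (b). [Ellis2006]
* S. Friedli, Y. Velenik, *Statistical Mechanics of Lattice Systems*, CUP (2017), Lemma 3.31 (1), Remark 3.41, §3.7.4,
  Exercise 3.34. [FriedliVelenik2017]
* M. Aizenman, D. J. Barsky, R. Fernández, J. Stat. Phys. 47 (1987) 343–374, Thm. 1 (`χ(β_c) = ∞`).
  [AizenmanBarskyFernandezJSP1987]
* M. Aizenman, H. Duminil-Copin, V. Sidoravicius, Comm. Math. Phys. 334 (2015) 719–742, Thm. 1.2 (`m*(β_c) = 0`).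
  [AizenmanDuminilCopinSidoraviciusCMP2015]
-/

noncomputable section

namespace Summit.CriticalPhenomena.PercolationContinuityZ3.Theorems.FK

namespace IsingSusceptibility

open MeasureTheory Filter Topology Finset Set intervalIntegral
open scoped symmDiff
open Literature.Probability.LatticeModels
open Summit.CriticalPhenomena.PercolationContinuityZ3.Theorems.FK.IsingCLT

variable {d : ℕ}

/-! ### `m(β,·)` is right-continuous at `h = 0` -/

/-- **`m(β,h) → m*(β)` as `h ↓ 0` within `[0,∞)`** (`β ≥ 0`): the plus magnetisation is right-continuous in the field
(Friedli–Velenik Lemma 3.31 (1); tree theorem `plusCorr_continuousWithinAt_Ici_field` at `A = {0}`), and `m(β,0) = m*(β)`.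
[cite: FriedliVelenik2017, Lemma 3.31 (1)] -/
theorem continuousWithinAt_magnetizationInField_Ici_zero {β : ℝ} (hβ : 0 ≤ β) :
    ContinuousWithinAt (fun t => magnetizationInField d β t) (Ici 0) 0 := by
  have hm : ∀ t, magnetizationInField d β t = plusCorr d β t {0} := fun t => by
    simp only [magnetizationInField, plusCorr, spinProduct_singleton]
  simp only [hm]
  exact plusCorr_continuousWithinAt_Ici_field hβ {0} le_rfl

/-- `m(β,h) → m*(β)` as `h ↓ 0`, `h > 0` (`β ≥ 0`). [cite: FriedliVelenik2017, Lemma 3.31 (1)] -/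
theorem tendsto_magnetizationInField_nhdsGT_zero {β : ℝ} (hβ : 0 ≤ β) :
    Tendsto (fun t => magnetizationInField d β t) (𝓝[>] 0) (𝓝 (spontaneousMagnetization d β)) := by
  have h := (continuousWithinAt_magnetizationInField_Ici_zero (d := d) hβ).tendsto
  rw [magnetizationInField_zero] at h
  exact h.mono_left (nhdsWithin_mono _ Ioi_subset_Ici_self)

/-! ### The truncated integrals `∫_{(a,h]} σ²` and their uniform bound -/

/-- `σ²(β,t) ≥ 0` for `β ≥ 0` (termwise GHS / Griffiths, `plusTruncated_nonneg`). [cite: Ellis2006, Lemma V.7.3 (b)] -/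
theorem tsum_plusTruncated_nonneg {β : ℝ} (hβ : 0 ≤ β) (t : ℝ) :
    0 ≤ ∑' z : Site d, (plusCorr d β t ({0} ∆ {z}) - plusCorr d β t {0} * plusCorr d β t {z}) :=
  tsum_nonneg fun z => plusTruncated_nonneg hβ t 0 z

/-- **`∫_{(a,h]} σ²(β,t) dt = (m(β,h) − m(β,a))/β`** for `β > 0`, `0 < a ≤ h` (the sum rule divided by `β`).
[cite: Ellis2006, Lemma V.7.4, eq. (5.28)] -/
theorem setIntegral_tsum_plusTruncated_Ioc_eq {β a h : ℝ} (hβ : 0 < β) (ha : 0 < a) (hah : a ≤ h) :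
    ∫ t in Ioc a h, ∑' z : Site d, (plusCorr d β t ({0} ∆ {z}) - plusCorr d β t {0} * plusCorr d β t {z}) =
      (magnetizationInField d β h - magnetizationInField d β a) / β := by
  rw [← integral_of_le hah, eq_div_iff hβ.ne', mul_comm, ← intervalIntegral.integral_const_mul]
  exact integral_mul_tsum_plusTruncated_eq hβ ha hah

/-- **`∫_{(a,h]} σ²(β,t) dt ≤ (m(β,h) − m*(β))/β`** uniformly in `0 < a ≤ h` (`m(β,a) ≥ m*(β)`).
[cite: Ellis2006, Lemma V.7.4] -/
theorem setIntegral_tsum_plusTruncated_Ioc_le {β a h : ℝ} (hβ : 0 < β) (ha : 0 < a) (hah : a ≤ h) :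
    ∫ t in Ioc a h, ∑' z : Site d, (plusCorr d β t ({0} ∆ {z}) - plusCorr d β t {0} * plusCorr d β t {z}) ≤
      (magnetizationInField d β h - spontaneousMagnetization d β) / β := by
  rw [setIntegral_tsum_plusTruncated_Ioc_eq hβ ha hah]
  refine div_le_div_of_nonneg_right ?_ hβ.le
  rw [← magnetizationInField_zero]
  linarith [monotoneOn_magnetizationInField (d := d) hβ.le (mem_Ici.2 le_rfl) (mem_Ici.2 ha.le) ha.le]

/-! ### Integrability of `σ²(β,·)` on `(0, h]` -/

/-- **`σ²(β,·) ∈ L¹((0,h])`** for `β > 0`, `h > 0`: `σ²` is nonnegative, integrable on every `(a,h]`, `a > 0`, with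
`∫_{(a,h]} σ² ≤ (m(β,h) − m*(β))/β` uniformly — hence integrable up to `0`, although `σ²(β,0⁺)` may be `+∞` (e.g. at `β_c`).
[cite: Ellis2006, Lemma V.7.4, eq. (5.28); FriedliVelenik2017, §3.7.4] -/
theorem integrableOn_tsum_plusTruncated_Ioc {β h : ℝ} (hβ : 0 < β) (hh : 0 < h) :
    IntegrableOn (fun t => ∑' z : Site d, (plusCorr d β t ({0} ∆ {z}) - plusCorr d β t {0} * plusCorr d β t {z}))
      (Ioc 0 h) := by
  -- exhaust `(0,h]` by `(h/(n+2), h]`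
  have ha : ∀ n : ℕ, 0 < h / (n + 2) := fun n => div_pos hh (by positivity)
  have hah : ∀ n : ℕ, h / (n + 2) ≤ h := fun n => div_le_self hh.le (by norm_cast; omega)
  have hlim : Tendsto (fun n : ℕ => h / (n + 2)) atTop (𝓝 0) := by
    have h1 : Tendsto (fun n : ℕ => ((n : ℝ) + 2)) atTop atTop :=
      tendsto_atTop_add_const_right _ 2 tendsto_natCast_atTop_atTop
    simpa using tendsto_const_nhds.div_atTop h1
  refine integrableOn_Ioc_of_intervalIntegral_norm_bounded_left (l := atTop)
    (I := (magnetizationInField d β h - spontaneousMagnetization d β) / β) (fun n => ?_) hlim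
    (Eventually.of_forall fun n => ?_)
  · exact (intervalIntegrable_iff_integrableOn_Ioc_of_le (hah n)).1
      (intervalIntegrable_tsum_plusTruncated hβ (ha n) hh)
  · refine le_trans (le_of_eq (setIntegral_congr_fun measurableSet_Ioc fun t ht => ?_))
      (setIntegral_tsum_plusTruncated_Ioc_le hβ (ha n) (hah n))
    exact Real.norm_of_nonneg (tsum_plusTruncated_nonneg hβ.le t)

/-- `σ²(β,·)` is interval-integrable on `[0, h]` (`β > 0`, `h > 0`). [cite: Ellis2006, Lemma V.7.4] -/
theorem intervalIntegrable_tsum_plusTruncated_zero {β h : ℝ} (hβ : 0 < β) (hh : 0 < h) :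
    IntervalIntegrable (fun t => ∑' z : Site d, (plusCorr d β t ({0} ∆ {z}) - plusCorr d β t {0} * plusCorr d β t {z}))
      volume 0 h :=
  (intervalIntegrable_iff_integrableOn_Ioc_of_le hh.le).2 (integrableOn_tsum_plusTruncated_Ioc hβ hh)

/-! ### THE IMPROPER SUM RULE -/

/-- **THE IMPROPER SUSCEPTIBILITY SUM RULE `∫_{(0,h]} β σ²(β,t) dt = m(β,h) − m*(β)`** (`β > 0`, `h > 0`): the
fluctuation–response theorem integrated all the way down to zero field (monotone exhaustion `(h/(n+2), h] ↑ (0,h]`,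
`∫_{(h/(n+2),h]} β σ² = m(h) − m(h/(n+2)) → m(h) − m*(β)` by the right-continuity of `m(β,·)` at `0`).
[cite: Ellis2006, Lemma V.7.4, eq. (5.28); FriedliVelenik2017, §3.7.4 and Lemma 3.31 (1)] -/
theorem integral_mul_tsum_plusTruncated_Ioc_zero_eq {β h : ℝ} (hβ : 0 < β) (hh : 0 < h) :
    ∫ t in Ioc 0 h, β * ∑' z : Site d, (plusCorr d β t ({0} ∆ {z}) - plusCorr d β t {0} * plusCorr d β t {z}) =
      magnetizationInField d β h - spontaneousMagnetization d β := by
  have ha : ∀ n : ℕ, 0 < h / (n + 2) := fun n => div_pos hh (by positivity)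
  have hah : ∀ n : ℕ, h / (n + 2) ≤ h := fun n => div_le_self hh.le (by norm_cast; omega)
  have hlim : Tendsto (fun n : ℕ => h / (n + 2)) atTop (𝓝 0) := by
    have h1 : Tendsto (fun n : ℕ => ((n : ℝ) + 2)) atTop atTop :=
      tendsto_atTop_add_const_right _ 2 tendsto_natCast_atTop_atTop
    simpa using tendsto_const_nhds.div_atTop h1
  -- the exhaustion is monotone with union `(0, h]`
  have hmono : Monotone fun n : ℕ => Ioc (h / (n + 2)) h := by
    intro m n hmn
    refine Ioc_subset_Ioc (div_le_div_of_nonneg_left hh.le (by positivity) ?_) le_rfl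
    exact_mod_cast Nat.add_le_add_right hmn 2
  have hU : (⋃ n : ℕ, Ioc (h / (n + 2)) h) = Ioc 0 h := by
    refine Subset.antisymm (iUnion_subset fun n => Ioc_subset_Ioc (ha n).le le_rfl) fun t ht => ?_
    obtain ⟨n, hn⟩ := (hlim.eventually (gt_mem_nhds ht.1)).exists
    exact mem_iUnion.2 ⟨n, hn, ht.2⟩
  have hint : IntegrableOn
      (fun t => β * ∑' z : Site d, (plusCorr d β t ({0} ∆ {z}) - plusCorr d β t {0} * plusCorr d β t {z}))
      (⋃ n : ℕ, Ioc (h / (n + 2)) h) := by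
    rw [hU]
    exact (integrableOn_tsum_plusTruncated_Ioc hβ hh).const_mul β
  have h1 := tendsto_setIntegral_of_monotone (fun n => measurableSet_Ioc) hmono hint
  rw [hU] at h1
  -- the truncated integrals are `m(h) − m(h/(n+2)) → m(h) − m*`
  have h2 : Tendsto (fun n : ℕ => ∫ t in Ioc (h / (n + 2)) h,
      β * ∑' z : Site d, (plusCorr d β t ({0} ∆ {z}) - plusCorr d β t {0} * plusCorr d β t {z})) atTop
      (𝓝 (magnetizationInField d β h - spontaneousMagnetization d β)) := by
    have heq : ∀ n : ℕ, ∫ t in Ioc (h / (n + 2)) h,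
        β * ∑' z : Site d, (plusCorr d β t ({0} ∆ {z}) - plusCorr d β t {0} * plusCorr d β t {z}) =
        magnetizationInField d β h - magnetizationInField d β (h / (n + 2)) := fun n => by
      rw [← integral_of_le (hah n)]
      exact integral_mul_tsum_plusTruncated_eq hβ (ha n) (hah n)
    simp only [heq]
    refine tendsto_const_nhds.sub ((tendsto_magnetizationInField_nhdsGT_zero hβ.le).comp ?_)
    exact tendsto_nhdsWithin_iff.2 ⟨hlim, Eventually.of_forall fun n => ha n⟩
  exact tendsto_nhds_unique h1 h2

/-- **Interval form: `∫_0^h β σ²(β,t) dt = m(β,h) − m*(β)`** (`β > 0`, `h > 0`; the sum rule of `SusceptibilitySumRule`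
extended to the endpoint `a = 0`). [cite: Ellis2006, Lemma V.7.4, eq. (5.28); FriedliVelenik2017, §3.7.4] -/
theorem integral_mul_tsum_plusTruncated_eq_zero {β h : ℝ} (hβ : 0 < β) (hh : 0 < h) :
    ∫ t in (0 : ℝ)..h, β * ∑' z : Site d, (plusCorr d β t ({0} ∆ {z}) - plusCorr d β t {0} * plusCorr d β t {z}) =
      magnetizationInField d β h - spontaneousMagnetization d β := by
  rw [integral_of_le hh.le]
  exact integral_mul_tsum_plusTruncated_Ioc_zero_eq hβ hh

/-- **`m(β,h) = m*(β) + ∫_0^h β σ²(β,t) dt`** for `β > 0`, `h ≥ 0`: the magnetisation curve is the spontaneous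
magnetisation plus the accumulated susceptibility. [cite: Ellis2006, Lemma V.7.4, eq. (5.28); FriedliVelenik2017, §3.7.4] -/
theorem magnetizationInField_eq_add_integral {β h : ℝ} (hβ : 0 < β) (hh : 0 ≤ h) :
    magnetizationInField d β h = spontaneousMagnetization d β +
      ∫ t in (0 : ℝ)..h, β * ∑' z : Site d, (plusCorr d β t ({0} ∆ {z}) - plusCorr d β t {0} * plusCorr d β t {z}) := by
  rcases hh.eq_or_lt with rfl | hh'
  · simp [magnetizationInField_zero]
  rw [integral_mul_tsum_plusTruncated_eq_zero hβ hh']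
  ring

/-- **`∫_{(0,h]} σ²(β,t) dt = (m(β,h) − m*(β))/β ≤ (1 − m*(β))/β`** (`β > 0`, `h > 0`): the susceptibility mass near zero
field is finite and at most `(1 − m*(β))/β`, at every temperature. [cite: Ellis2006, Lemma V.7.4 and Thm. V.7.2 (b)] -/
theorem integral_tsum_plusTruncated_Ioc_le {β h : ℝ} (hβ : 0 < β) (hh : 0 < h) :
    ∫ t in Ioc 0 h, ∑' z : Site d, (plusCorr d β t ({0} ∆ {z}) - plusCorr d β t {0} * plusCorr d β t {z}) ≤
      (1 - spontaneousMagnetization d β) / β := by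
  have h1 : ∫ t in Ioc 0 h, ∑' z : Site d, (plusCorr d β t ({0} ∆ {z}) - plusCorr d β t {0} * plusCorr d β t {z}) =
      (magnetizationInField d β h - spontaneousMagnetization d β) / β := by
    rw [eq_div_iff hβ.ne', mul_comm, ← MeasureTheory.integral_const_mul]
    exact integral_mul_tsum_plusTruncated_Ioc_zero_eq hβ hh
  rw [h1]
  refine div_le_div_of_nonneg_right ?_ hβ.le
  have hm : magnetizationInField d β h = plusCorr d β h {0} := by
    simp only [magnetizationInField, plusCorr, spinProduct_singleton]
  linarith [plusCorr_le_one (d := d) hβ.le hh.le {0}]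

/-! ### At the critical point: `σ²(β_c,·)` diverges at `0⁺` yet integrates to the critical isotherm -/

/-- **`σ²(β_c, 0) = χ(β_c) = ∞`** (`d ≥ 2`): the zero-field plus truncated two-point function at `β_c` — equal to
`⟨σ_0σ_z⟩_{β_c}` since `m*(β_c) = 0` — is not summable (tree theorem `susceptibility_eq_top_of_criticalBeta_le`,
Aizenman–Barsky–Fernández). [cite: AizenmanBarskyFernandezJSP1987, Thm. 1; Ellis2006, Thm. V.8.3 (d)] -/
theorem not_summable_plusTruncated_zero_field_criticalBeta (hd : 2 ≤ d) :
    ¬ Summable fun z : Site d => plusCorr d (criticalBeta d) 0 ({0} ∆ {z}) -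
      plusCorr d (criticalBeta d) 0 {0} * plusCorr d (criticalBeta d) 0 {z} := by
  have hβ : 0 < criticalBeta d := criticalBeta_pos_holds hd
  have hfun : (fun z : Site d => plusCorr d (criticalBeta d) 0 ({0} ∆ {z}) -
      plusCorr d (criticalBeta d) 0 {0} * plusCorr d (criticalBeta d) 0 {z}) = twoPointFree d (criticalBeta d) :=
    funext fun z => plusTruncated_zero_field_eq_twoPointFree hd hβ.le le_rfl z
  rw [hfun]
  intro hsum
  have htop := susceptibility_eq_top_of_criticalBeta_le hd (le_refl (criticalBeta d))
  have h0 : ∀ z : Site d, 0 ≤ twoPointFree d (criticalBeta d) z := fun z => by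
    rw [← plusTruncated_zero_field_eq_twoPointFree hd hβ.le le_rfl z]
    exact plusTruncated_nonneg hβ.le 0 0 z
  rw [susceptibility, ← ENNReal.ofReal_tsum_of_nonneg h0 hsum] at htop
  exact ENNReal.ofReal_ne_top htop

/-- **`σ²(β_c, t) → ∞` as `t ↓ 0`** (`d ≥ 2`): the in-field susceptibility at the critical temperature diverges at
zero field (monotone convergence to the non-summable `χ(β_c)`). [cite: AizenmanBarskyFernandezJSP1987, Thm. 1; Ellis2006, Lemma V.7.4 (b)] -/
theorem tendsto_tsum_plusTruncated_atTop_criticalBeta (hd : 2 ≤ d) :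
    Tendsto (fun t => ∑' z : Site d, (plusCorr d (criticalBeta d) t ({0} ∆ {z}) -
      plusCorr d (criticalBeta d) t {0} * plusCorr d (criticalBeta d) t {z})) (𝓝[>] 0) atTop :=
  tendsto_tsum_plusTruncated_atTop_of_not_summable (criticalBeta_pos_holds hd) le_rfl
    (not_summable_plusTruncated_zero_field_criticalBeta hd)

/-- **THE CRITICAL ISOTHERM IS THE INTEGRATED DIVERGENT SUSCEPTIBILITY**: for `d ≥ 2` and `h > 0`,
`∫_{(0,h]} β_c σ²(β_c,t) dt = m(β_c, h)` — finite, although the integrand tends to `+∞` at `0⁺`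
(`tendsto_tsum_plusTruncated_atTop_criticalBeta`); `m*(β_c) = 0` is the tree's continuity theorem.
[cite: Ellis2006, Lemma V.7.4, eq. (5.28); AizenmanDuminilCopinSidoraviciusCMP2015, Thm. 1.2] -/
theorem integral_mul_tsum_plusTruncated_Ioc_zero_criticalBeta (hd : 2 ≤ d) {h : ℝ} (hh : 0 < h) :
    ∫ t in Ioc 0 h, criticalBeta d * ∑' z : Site d, (plusCorr d (criticalBeta d) t ({0} ∆ {z}) -
      plusCorr d (criticalBeta d) t {0} * plusCorr d (criticalBeta d) t {z}) = magnetizationInField d (criticalBeta d) h := by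
  rw [integral_mul_tsum_plusTruncated_Ioc_zero_eq (criticalBeta_pos_holds hd) hh,
    spontaneousMagnetization_eq_zero_of_le_criticalBeta_two_le hd (criticalBeta_pos_holds hd).le le_rfl, sub_zero]

end IsingSusceptibility

end Summit.CriticalPhenomena.PercolationContinuityZ3.Theorems.FK

end
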